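import Literature.Probability.RandomPlanarGeometry.SAWQuantitativeHW
import HarnessLib

/-!
# Quantitative Hammersley–Welsh from quantitative bridge sub-ballisticity, II: Hutchcroft 2018,
# Corollary 1.5 with an explicit constant, and Remark 2.5 (`ν ≤ 1` is impossible)

Topic `Literature/Probability/RandomPlanarGeometry` (continues `SAWQuantitativeHW.lean`, whose module
docstring carries the source displays and the READING NOTE on the repaired hypothesis
`BridgeHeightDecay d ν A C` = Hutchcroft's (1.1) with `φ(ε) = Cε^ν` and a prefactor `A`). Source:
T. Hutchcroft, Electron. Commun. Probab. 23 (2018) no. 5 (arXiv:1708.09460), Corollary 1.5: "Let `d ≥ 2`,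
and suppose that `φ(ε) = Cε^ν` satisfies (1.1) for some `ν > 1` and `C > 0`. Then
`c_n ≤ exp[O(n^{(ν-1)/(2ν-1)})] μ_c^n`"; proof: "`ψ(ε) ≥ C' ε^{-1/ν}` … `Ψ(n) = O(n^{α(ν-1)/ν} + n^{1-α})`
… Optimizing by taking `α = ν/(2ν-1)`."

Here the `O(·)` is made explicit and valid for ALL `n ≥ 1` and all `d ≥ 1` (for `d = 1` the hypothesis
is unsatisfiable): with `β = (ν-1)/(2ν-1)`, `ℓ = ⌈n^{1/(2ν-1)}⌉`, `ε = min(1/2,C) ℓ^{-ν}` in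
`count_le_of_heightDecay`, `ρ ≤ exp(-min(1/2,C) ℓ^{1-ν})`, `2ρ/(1-ρ) ≤ (4 · 2^{ν-1}/min(1/2,C)) n^β`,
`(1-ε)^{-(n+1)} ≤ e^{4εn} ≤ e^{2n^β}`, `μ ≤ e^{(log μ) n^β}`.

## Contents (namespace `Literature.Probability.RandomPlanarGeometry.SAW.Zd`; all PROVED)

* **`count_le_exp_rpow_of_heightDecay`** — `BridgeHeightDecay d ν A C`, `ν > 1`, `C > 0`, `n ≥ 1` ⇒
  `c_n ≤ exp(K n^β) μⁿ` with `K = 4 · 2^{ν-1}/min(1/2,C) + 2 + log μ`;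
* **`exists_count_le_exp_rpow_of_heightDecay`** — the `∃ K, ∀ n ≥ 1` form (the shape in which the lane
  pcv-sawmu states its schema `QBSB(ν) → QHW(ν)`, now a theorem for every `d`);
* `hwExponent_lt_half` — `(ν-1)/(2ν-1) < 1/2` for `ν > 1`;
* **`not_bridgeHeightDecay_of_le_one`** — Remark 2.5 in kernel form: for `ν ≤ 1`, `C > 0` the hypothesis
  is FALSE on every `ℤ^d` (windows at all scales with the same rate ⇒ `a(z_c;n) ≤ e^{-Cn}` ⇒ `B(z_c) < ∞`,
  against Kesten's divergence `MadrasSlade1993_cor318_holds`), so the range `ν > 1` of Cor. 1.5 is forced.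
-/

noncomputable section

open Finset Filter Topology Literature.Probability.LatticeModels Literature.Probability.Percolation
open scoped BigOperators

namespace Literature.Probability.RandomPlanarGeometry.SAW.Zd

variable {d : ℕ} [NeZero d]

/-! ### §E. Corollary 1.5: the choice `ℓ ≍ N^{1/(2ν-1)}`, `ε ≍ ℓ^{-ν}` -/

/-- `u/2 ≤ 1 - e^{-u}` for `0 ≤ u ≤ 1` (from `1 + u ≤ e^u`). [folklore] -/
private theorem half_le_one_sub_exp_neg {u : ℝ} (hu0 : 0 ≤ u) (hu1 : u ≤ 1) :
    u / 2 ≤ 1 - Real.exp (-u) := by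
  have h1 : Real.exp (-u) * (1 + u) ≤ 1 := by
    calc Real.exp (-u) * (1 + u) ≤ Real.exp (-u) * Real.exp u := by
          refine mul_le_mul_of_nonneg_left ?_ (Real.exp_nonneg _)
          have := Real.add_one_le_exp u
          linarith
      _ = 1 := by rw [← Real.exp_add, neg_add_cancel, Real.exp_zero]
  have h2 : 0 < Real.exp (-u) := Real.exp_pos _
  nlinarith

/-- `(1 - ε)⁻¹ ≤ exp(2ε)` for `0 ≤ ε ≤ 1/2`. [folklore] -/
private theorem inv_one_sub_le_exp {ε : ℝ} (hε0 : 0 ≤ ε) (hε1 : ε ≤ 1 / 2) :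
    (1 - ε)⁻¹ ≤ Real.exp (2 * ε) := by
  have h1 : 0 < 1 - ε := by linarith
  rw [inv_le_iff_one_le_mul₀ h1]
  have h2 : 1 + 2 * ε ≤ Real.exp (2 * ε) := by
    have := Real.add_one_le_exp (2 * ε)
    linarith
  nlinarith

/-- **Corollary 1.5 (repaired hypothesis), all `d ≥ 1`, explicit constant.** If the `n`-step bridges
of `ℤ^d` reaching height `m` number at most `A · bₙ · exp(-C (m/n)^ν n)` for all `n ≥ m > 0`
(`BridgeHeightDecay d ν A C`, `ν > 1`, `C > 0`), then for every `N ≥ 1`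
`c_N ≤ exp(K · N^{(ν-1)/(2ν-1)}) μ^N` with `K = 4 · 2^{ν-1} / min(1/2, C) + 2 + log μ`
("`c_n ≤ exp[O(n^{(ν-1)/(2ν-1)})] μ_c^n`"). Proof: §D with `ℓ = ⌈N^{1/(2ν-1)}⌉`, `ε = min(1/2,C) ℓ^{-ν}`:
then `ρ ≤ exp(-min(1/2,C) ℓ^{1-ν})`, `2ρ/(1-ρ) ≤ (4/min(1/2,C)) ℓ^{ν-1} ≤ (4·2^{ν-1}/min(1/2,C)) N^β`
and `(1-ε)^{-(N+1)} ≤ exp(4εN) ≤ exp(2 N^β)`, `β = (ν-1)/(2ν-1)`.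
[cite: Hutchcroft2018HammersleyWelsh, Corollary 1.5 (repaired hypothesis; `O(·)` made explicit)] -/
theorem count_le_exp_rpow_of_heightDecay {ν A C : ℝ} (h : BridgeHeightDecay d ν A C) (hν : 1 < ν)
    (hC : 0 < C) {N : ℕ} (hN : 1 ≤ N) :
    (count d N : ℝ) ≤
      Real.exp ((4 * (2 : ℝ) ^ (ν - 1) / min (1 / 2) C + 2 + Real.log (connectiveConstant d)) *
          (N : ℝ) ^ ((ν - 1) / (2 * ν - 1))) * connectiveConstant d ^ N := by
  -- exponents
  set β : ℝ := (ν - 1) / (2 * ν - 1) with hβ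
  set α : ℝ := 1 / (2 * ν - 1) with hα
  have h2ν : 0 < 2 * ν - 1 := by linarith
  have hα0 : 0 < α := by positivity
  have hβ0 : 0 ≤ β := by rw [hβ]; exact div_nonneg (by linarith) h2ν.le
  have hαβ : α * (ν - 1) = β := by rw [hα, hβ]; field_simp
  have hαβ' : -(α * ν) + 1 = β := by rw [hα, hβ]; field_simp; ring
  -- constants
  set μ : ℝ := connectiveConstant d with hμdef
  have hμ : 0 < μ := connectiveConstant_pos d
  have hμ1 : 1 ≤ μ := one_le_connectiveConstant d
  set c₁ : ℝ := min (1 / 2) C with hc₁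
  have hc₁0 : 0 < c₁ := lt_min (by norm_num) hC
  have hc₁h : c₁ ≤ 1 / 2 := min_le_left _ _
  have hc₁C : c₁ ≤ C := min_le_right _ _
  -- `t = N^α ≥ 1`, `ℓ = ⌈t⌉`
  have hN0 : (0 : ℝ) < N := by exact_mod_cast hN
  have hN1 : (1 : ℝ) ≤ N := by exact_mod_cast hN
  set t : ℝ := (N : ℝ) ^ α with ht
  have ht1 : 1 ≤ t := Real.one_le_rpow hN1 hα0.le
  have ht0 : 0 < t := by linarith
  set ℓ : ℕ := ⌈t⌉₊ with hℓ
  have hℓ1 : 1 ≤ ℓ := Nat.one_le_ceil_iff.2 ht0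
  have hℓt : t ≤ (ℓ : ℝ) := Nat.le_ceil t
  have hℓ2t : (ℓ : ℝ) ≤ 2 * t := by
    have := Nat.ceil_lt_add_one ht0.le
    rw [← hℓ] at this
    linarith
  have hℓ0 : (0 : ℝ) < ℓ := by exact_mod_cast hℓ1
  have hℓ1' : (1 : ℝ) ≤ ℓ := by exact_mod_cast hℓ1
  -- `ε = c₁ ℓ^{-ν} ∈ (0, 1/2]`
  have hℓν1 : (ℓ : ℝ) ^ (-ν) ≤ 1 := Real.rpow_le_one_of_one_le_of_nonpos hℓ1' (by linarith)
  have hℓν0 : 0 < (ℓ : ℝ) ^ (-ν) := Real.rpow_pos_of_pos hℓ0 _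
  set ε : ℝ := c₁ * (ℓ : ℝ) ^ (-ν) with hε
  have hε0 : 0 < ε := mul_pos hc₁0 hℓν0
  have hεh : ε ≤ 1 / 2 := by
    calc ε ≤ c₁ * 1 := mul_le_mul_of_nonneg_left hℓν1 hc₁0.le
      _ ≤ 1 / 2 := by linarith
  have hε1 : ε < 1 := by linarith
  -- `u = c₁ ℓ^{1-ν} ∈ (0, 1/2]`
  have hℓ1ν1 : (ℓ : ℝ) ^ (1 - ν) ≤ 1 := Real.rpow_le_one_of_one_le_of_nonpos hℓ1' (by linarith)
  have hℓ1ν0 : 0 < (ℓ : ℝ) ^ (1 - ν) := Real.rpow_pos_of_pos hℓ0 _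
  set u : ℝ := c₁ * (ℓ : ℝ) ^ (1 - ν) with hu
  have hu0 : 0 < u := mul_pos hc₁0 hℓ1ν0
  have hu1 : u ≤ 1 := by
    calc u ≤ c₁ * 1 := mul_le_mul_of_nonneg_left hℓ1ν1 hc₁0.le
      _ ≤ 1 := by linarith
  -- the finite-form bound of §D
  set ρ : ℝ := max ((1 - ε) ^ ℓ) ((1 - ε) * Real.exp (-(C * (ℓ : ℝ) ^ (1 - ν)))) with hρ
  have key := count_le_of_heightDecay h hν.le hC.le hε0 hε1 hℓ1 N
  rw [← hρ, ← hμdef] at key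
  -- `ρ ≤ exp(-u)`
  have hρu : ρ ≤ Real.exp (-u) := by
    refine max_le ?_ ?_
    · calc (1 - ε) ^ ℓ ≤ Real.exp (-ε) ^ ℓ :=
            pow_le_pow_left₀ (by linarith) (Real.one_sub_le_exp_neg ε) ℓ
        _ = Real.exp (-u) := by
            rw [← Real.exp_nat_mul]
            congr 1
            rw [hu, hε, show (1 : ℝ) - ν = -ν + 1 by ring, Real.rpow_add_one hℓ0.ne']
            ring
    · calc (1 - ε) * Real.exp (-(C * (ℓ : ℝ) ^ (1 - ν))) ≤ 1 * Real.exp (-(C * (ℓ : ℝ) ^ (1 - ν))) :=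
            mul_le_mul_of_nonneg_right (by linarith) (Real.exp_nonneg _)
        _ ≤ Real.exp (-u) := by
            rw [one_mul, Real.exp_le_exp, hu, neg_le_neg_iff]
            exact mul_le_mul_of_nonneg_right hc₁C hℓ1ν0.le
  have hρ1 : ρ ≤ 1 := hρu.trans (by rw [Real.exp_le_one_iff]; linarith)
  have hρ0 : 0 ≤ ρ := le_max_of_le_left (pow_nonneg (by linarith) ℓ)
  -- `1 - ρ ≥ u/2`, so `2ρ/(1-ρ) ≤ 4/u = (4/c₁) ℓ^{ν-1} ≤ (4 · 2^{ν-1}/c₁) N^β`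
  have h1ρ : u / 2 ≤ 1 - ρ := (half_le_one_sub_exp_neg hu0.le hu1).trans (by linarith)
  have h1ρ0 : 0 < 1 - ρ := lt_of_lt_of_le (by linarith) h1ρ
  have hexp1 : 2 * (ρ / (1 - ρ)) ≤ (4 * (2 : ℝ) ^ (ν - 1) / c₁) * (N : ℝ) ^ β := by
    have e1 : ρ / (1 - ρ) ≤ 1 / (u / 2) := div_le_div₀ zero_le_one hρ1 (by linarith) h1ρ
    have e2 : 1 / (u / 2) = (2 / c₁) * (ℓ : ℝ) ^ (ν - 1) := by
      rw [hu, show (1 : ℝ) - ν = -(ν - 1) by ring, Real.rpow_neg hℓ0.le]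
      field_simp
    have e3 : (ℓ : ℝ) ^ (ν - 1) ≤ (2 : ℝ) ^ (ν - 1) * (N : ℝ) ^ β := by
      calc (ℓ : ℝ) ^ (ν - 1) ≤ (2 * t) ^ (ν - 1) := Real.rpow_le_rpow hℓ0.le hℓ2t (by linarith)
        _ = (2 : ℝ) ^ (ν - 1) * t ^ (ν - 1) := Real.mul_rpow (by norm_num) ht0.le
        _ = (2 : ℝ) ^ (ν - 1) * (N : ℝ) ^ β := by
            rw [ht, ← Real.rpow_mul hN0.le, hαβ]
    calc 2 * (ρ / (1 - ρ)) ≤ 2 * ((2 / c₁) * (ℓ : ℝ) ^ (ν - 1)) := by rw [← e2]; linarith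
      _ ≤ 2 * ((2 / c₁) * ((2 : ℝ) ^ (ν - 1) * (N : ℝ) ^ β)) := by gcongr
      _ = (4 * (2 : ℝ) ^ (ν - 1) / c₁) * (N : ℝ) ^ β := by ring
  -- `(1-ε)^{-(N+1)} ≤ exp(2ε(N+1)) ≤ exp(2 N^β)`
  have hexp2 : ((1 - ε) ^ (N + 1))⁻¹ ≤ Real.exp (2 * (N : ℝ) ^ β) := by
    have e1 : ((1 - ε) ^ (N + 1))⁻¹ ≤ Real.exp (2 * ε) ^ (N + 1) := by
      rw [← inv_pow]
      exact pow_le_pow_left₀ (inv_nonneg.2 (by linarith)) (inv_one_sub_le_exp hε0.le hεh) _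
    have e2 : Real.exp (2 * ε) ^ (N + 1) = Real.exp (((N + 1 : ℕ) : ℝ) * (2 * ε)) := by
      rw [Real.exp_nat_mul]
    have e3 : ((N + 1 : ℕ) : ℝ) * (2 * ε) ≤ 2 * (N : ℝ) ^ β := by
      have f1 : ((N + 1 : ℕ) : ℝ) ≤ 2 * N := by push_cast; linarith
      have f2 : ε * N ≤ (1 / 2) * (N : ℝ) ^ β := by
        calc ε * N = c₁ * ((ℓ : ℝ) ^ (-ν) * N) := by rw [hε]; ring
          _ ≤ (1 / 2) * (t ^ (-ν) * N) := by
              refine mul_le_mul hc₁h ?_ (by positivity) (by norm_num)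
              exact mul_le_mul_of_nonneg_right (Real.rpow_le_rpow_of_nonpos ht0 hℓt (by linarith))
                hN0.le
          _ = (1 / 2) * (N : ℝ) ^ β := by
              rw [ht, ← Real.rpow_mul hN0.le, ← Real.rpow_add_one hN0.ne',
                show α * -ν + 1 = -(α * ν) + 1 by ring, hαβ']
      calc ((N + 1 : ℕ) : ℝ) * (2 * ε) ≤ (2 * N) * (2 * ε) :=
            mul_le_mul_of_nonneg_right f1 (by linarith)
        _ = 4 * (ε * N) := by ring
        _ ≤ 4 * ((1 / 2) * (N : ℝ) ^ β) := by linarith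
        _ = 2 * (N : ℝ) ^ β := by ring
    rw [e2] at e1
    exact e1.trans (Real.exp_le_exp.2 e3)
  -- `μ^{N+1} = μ · μ^N ≤ exp(log μ · N^β) μ^N`
  have hNβ1 : 1 ≤ (N : ℝ) ^ β := Real.one_le_rpow hN1 hβ0
  have hexp3 : μ ≤ Real.exp (Real.log μ * (N : ℝ) ^ β) := by
    calc μ = Real.exp (Real.log μ) := (Real.exp_log hμ).symm
      _ ≤ Real.exp (Real.log μ * (N : ℝ) ^ β) := by
          rw [Real.exp_le_exp]
          have := Real.log_nonneg hμ1
          nlinarith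
  -- assemble
  have hfin : Real.exp (2 * (ρ / (1 - ρ))) * μ ^ (N + 1) / (1 - ε) ^ (N + 1) ≤
      Real.exp ((4 * (2 : ℝ) ^ (ν - 1) / c₁ + 2 + Real.log μ) * (N : ℝ) ^ β) * μ ^ N := by
    rw [div_eq_mul_inv, pow_succ]
    calc Real.exp (2 * (ρ / (1 - ρ))) * (μ ^ N * μ) * ((1 - ε) ^ (N + 1))⁻¹
        ≤ Real.exp ((4 * (2 : ℝ) ^ (ν - 1) / c₁) * (N : ℝ) ^ β) *
            (μ ^ N * Real.exp (Real.log μ * (N : ℝ) ^ β)) * Real.exp (2 * (N : ℝ) ^ β) := by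
          gcongr
    _ = Real.exp ((4 * (2 : ℝ) ^ (ν - 1) / c₁ + 2 + Real.log μ) * (N : ℝ) ^ β) * μ ^ N := by
          rw [show (4 * (2 : ℝ) ^ (ν - 1) / c₁ + 2 + Real.log μ) * (N : ℝ) ^ β =
              (4 * (2 : ℝ) ^ (ν - 1) / c₁) * (N : ℝ) ^ β + Real.log μ * (N : ℝ) ^ β + 2 * (N : ℝ) ^ β
              by ring, Real.exp_add, Real.exp_add]
          ring
  exact key.trans hfin

/-- **Hutchcroft 2018, Corollary 1.5 — `∃ K` form, as the lane pcv-sawmu states it (`d` arbitrary):**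
`BridgeHeightDecay d ν A C` with `ν > 1`, `C > 0` implies `∃ K, ∀ n ≥ 1, cₙ ≤ exp(K n^{(ν-1)/(2ν-1)}) μⁿ`.
[cite: Hutchcroft2018HammersleyWelsh, Corollary 1.5 (repaired hypothesis)] -/
theorem exists_count_le_exp_rpow_of_heightDecay {ν A C : ℝ} (h : BridgeHeightDecay d ν A C)
    (hν : 1 < ν) (hC : 0 < C) :
    ∃ K : ℝ, ∀ n : ℕ, 1 ≤ n →
      (count d n : ℝ) ≤ Real.exp (K * (n : ℝ) ^ ((ν - 1) / (2 * ν - 1))) * connectiveConstant d ^ n :=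
  ⟨_, fun _ hn => count_le_exp_rpow_of_heightDecay h hν hC hn⟩

/-- The delivered Hammersley–Welsh exponent `(ν-1)/(2ν-1)` is strictly below `1/2` for `ν > 1`
(and tends to `1/2` as `ν → ∞`), so Corollary 1.5 is a genuine improvement of `exp(O(√n))`.
[cite: Hutchcroft2018HammersleyWelsh, Corollary 1.5] -/
theorem hwExponent_lt_half {ν : ℝ} (hν : 1 < ν) : (ν - 1) / (2 * ν - 1) < 1 / 2 := by
  rw [div_lt_div_iff₀ (by linarith) (by norm_num)]
  linarith

/-! ### Remark 2.5: no power law with `ν ≤ 1` (it would make `B(z_c)` finite, against Kesten) -/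

/-- For `ν ≤ 1` the power-law hypothesis gives a window at EVERY scale `ℓ` with the SAME rate `c = C`:
for `n ≤ m`, `(n/m)^ν ≥ n/m`, so `C (n/m)^ν m ≥ C n`.
[cite: Hutchcroft2018HammersleyWelsh, Remark 2.5 ("values of `ν ≤ 1` are not possible")] -/
theorem BridgeHeightDecay.window_of_le_one {ν A C : ℝ} (h : BridgeHeightDecay d ν A C) (hν : ν ≤ 1)
    (hC : 0 ≤ C) (ℓ : ℕ) : BridgeHeightDecayWindow d ℓ A C := by
  intro m n hn hnm _hmℓ
  refine (h m n hn hnm).trans ?_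
  have hA : 0 ≤ A := h.nonneg
  refine mul_le_mul_of_nonneg_left ?_ (by positivity)
  rw [Real.exp_le_exp, neg_le_neg_iff]
  have hn0 : (0 : ℝ) < n := by exact_mod_cast hn
  have hm0 : (0 : ℝ) < m := by exact_mod_cast (lt_of_lt_of_le hn hnm)
  have hq0 : 0 < (n : ℝ) / m := div_pos hn0 hm0
  have hq1 : (n : ℝ) / m ≤ 1 := (div_le_one hm0).2 (by exact_mod_cast hnm)
  have hq : (n : ℝ) / m ≤ ((n : ℝ) / m) ^ ν := by
    calc (n : ℝ) / m = ((n : ℝ) / m) ^ (1 : ℝ) := (Real.rpow_one _).symm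
      _ ≤ ((n : ℝ) / m) ^ ν := Real.rpow_le_rpow_of_exponent_ge hq0 hq1 hν
  calc C * (n : ℝ) = C * ((n : ℝ) / m * m) := by field_simp
    _ ≤ C * (((n : ℝ) / m) ^ ν * m) := by gcongr
    _ = C * ((n : ℝ) / m) ^ ν * m := by ring

/-- Under a power law with `ν ≤ 1`: `a((1-ε)z_c; n) ≤ ((1-ε) e^{-C})^n` for every `0 < ε < 1`, `n ≥ 1`
and every truncation (windows at all scales with the same rate; let `ℓ → ∞` in `brGF_subcrit_le_pow`).
[cite: Hutchcroft2018HammersleyWelsh, Remark 2.5] -/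
theorem brGF_subcrit_le_of_le_one {ν A C : ℝ} (h : BridgeHeightDecay d ν A C) (hν : ν ≤ 1)
    (hC : 0 ≤ C) {ε : ℝ} (hε0 : 0 < ε) (hε1 : ε < 1) (M : ℕ) {n : ℕ} (hn : 1 ≤ n) :
    brGF d M ((1 - ε) * (connectiveConstant d)⁻¹) n ≤ ((1 - ε) * Real.exp (-C)) ^ n := by
  have h1ε : 0 < 1 - ε := by linarith
  obtain ⟨ℓ₀, hℓ₀⟩ := exists_pow_lt_of_lt_one (show 0 < (1 - ε) * Real.exp (-C) by positivity)
    (show 1 - ε < 1 by linarith)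
  set ℓ : ℕ := max ℓ₀ 1 with hℓ
  have hle : (1 - ε) ^ ℓ ≤ (1 - ε) * Real.exp (-C) :=
    (pow_le_pow_of_le_one h1ε.le (by linarith) (le_max_left _ _)).trans hℓ₀.le
  have := brGF_subcrit_le_pow (h.window_of_le_one hν hC ℓ) (le_max_right _ _) hε0 hε1 M hn
  rwa [max_eq_right hle] at this

/-- … hence, letting `ε → 0` (continuity of the truncated sums), `a(z_c; n) ≤ e^{-Cn}` for all `n ≥ 1`.
[cite: Hutchcroft2018HammersleyWelsh, Remark 2.5] -/
theorem brGF_critical_le_of_le_one {ν A C : ℝ} (h : BridgeHeightDecay d ν A C) (hν : ν ≤ 1)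
    (hC : 0 ≤ C) (M : ℕ) {n : ℕ} (hn : 1 ≤ n) :
    brGF d M (connectiveConstant d)⁻¹ n ≤ Real.exp (-C) ^ n := by
  have hμ := connectiveConstant_pos d
  set zc : ℝ := (connectiveConstant d)⁻¹ with hzc
  have hzc0 : 0 < zc := inv_pos.2 hμ
  have hcont : Continuous fun z : ℝ => brGF d M z n :=
    continuous_finsetSum _ fun m _ => continuous_const.mul (continuous_pow m)
  have htend : Tendsto (fun z : ℝ => brGF d M z n) (𝓝[<] zc) (𝓝 (brGF d M zc n)) :=
    (hcont.tendsto zc).mono_left nhdsWithin_le_nhds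
  have hev : ∀ᶠ z in 𝓝[<] zc, brGF d M z n ≤ Real.exp (-C) ^ n := by
    have h1 : ∀ᶠ z in 𝓝[<] zc, 0 < z := (eventually_gt_nhds hzc0).filter_mono nhdsWithin_le_nhds
    have h2 : ∀ᶠ z in 𝓝[<] zc, z < zc := eventually_mem_nhdsWithin
    filter_upwards [h1, h2] with z hz0 hzlt
    -- `z = (1-ε) z_c` with `ε = 1 - zμ ∈ (0,1)`
    set ε : ℝ := 1 - z * connectiveConstant d with hε
    have hε0 : 0 < ε := by
      rw [hε, sub_pos]
      calc z * connectiveConstant d < zc * connectiveConstant d := mul_lt_mul_of_pos_right hzlt hμ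
        _ = 1 := inv_mul_cancel₀ hμ.ne'
    have hε1 : ε < 1 := by
      rw [hε]; nlinarith [mul_pos hz0 hμ]
    have hz : z = (1 - ε) * zc := by
      rw [hε, hzc]; field_simp; ring
    rw [hz]
    calc brGF d M ((1 - ε) * zc) n ≤ ((1 - ε) * Real.exp (-C)) ^ n :=
          brGF_subcrit_le_of_le_one h hν hC hε0 hε1 M hn
      _ ≤ (1 * Real.exp (-C)) ^ n :=
          pow_le_pow_left₀ (mul_nonneg (by linarith) (Real.exp_nonneg _))
            (mul_le_mul_of_nonneg_right (by linarith) (Real.exp_nonneg _)) n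
      _ = Real.exp (-C) ^ n := by rw [one_mul]
  exact le_of_tendsto htend hev

/-- **Remark 2.5, kernel form: NO power law `φ(ε) = Cε^ν` with `ν ≤ 1` (and `C > 0`) can satisfy the
(repaired) hypothesis (1.1), on any `ℤ^d`** — it would give `a(z_c;n) ≤ e^{-Cn}`, hence
`B(z_c) ≤ 1 + Σ_{n≥1} e^{-Cn} < ∞`, contradicting Kesten's `B(z_c) = ∞` (Madras–Slade Cor. 3.1.8, tree
`MadrasSlade1993_cor318_holds`). (Hutchcroft argues via the finer bound
`B((1-ε)z_c) ≥ 1 + ½log[(1-ε)z_c] + ½log ε^{-1}`; divergence suffices for `ν ≤ 1`.)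
[cite: Hutchcroft2018HammersleyWelsh, Remark 2.5; MadrasSlade1993, Corollary 3.1.8] -/
theorem not_bridgeHeightDecay_of_le_one {ν A C : ℝ} (hν : ν ≤ 1) (hC : 0 < C) :
    ¬ BridgeHeightDecay d ν A C := by
  intro h
  have hμ := connectiveConstant_pos d
  set ρ : ℝ := Real.exp (-C) with hρ
  have hρ0 : 0 ≤ ρ := Real.exp_nonneg _
  have hρ1 : ρ < 1 := Real.exp_lt_one_iff.2 (by linarith)
  have hB : ∀ M : ℕ, bridgeGFpos d M (connectiveConstant d)⁻¹ ≤ ρ / (1 - ρ) := fun M =>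
    bridgeGFpos_le_of_brGF_le M (inv_nonneg.2 hμ.le) hρ0 hρ1
      fun A hA => brGF_critical_le_of_le_one h hν hC.le M hA
  refine MadrasSlade1993_cor318_holds d (summable_of_sum_range_le (c := 1 + ρ / (1 - ρ))
    (fun N => by positivity) fun M => ?_)
  -- `Σ_{N<M} b_N μ^{-N} ≤ Σ_{N≤M} b_N μ^{-N} = 1 + B⁺_M(z_c) ≤ 1 + ρ/(1-ρ)`
  have hterm : ∀ N : ℕ, (bridgeCount d N : ℝ) / connectiveConstant d ^ N =
      (if N = 0 then (0 : ℝ) else (bridgeCount d N : ℝ) * (connectiveConstant d)⁻¹ ^ N) +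
        (if N = 0 then (1 : ℝ) else 0) := by
    intro N
    split_ifs with hN
    · subst hN
      have h1 : bridgeCount d 0 = 1 :=
        le_antisymm ((bridgeCount_le_count 0).trans (count_zero d).le) (one_le_bridgeCount 0)
      simp [h1]
    · rw [inv_pow, div_eq_mul_inv, add_zero]
  calc ∑ N ∈ Finset.range M, (bridgeCount d N : ℝ) / connectiveConstant d ^ N
      ≤ ∑ N ∈ Finset.range (M + 1), (bridgeCount d N : ℝ) / connectiveConstant d ^ N :=
        Finset.sum_le_sum_of_subset_of_nonneg (Finset.range_mono (Nat.le_succ M))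
          fun N _ _ => by positivity
    _ = bridgeGFpos d M (connectiveConstant d)⁻¹ + 1 := by
        rw [Finset.sum_congr rfl fun N _ => hterm N, Finset.sum_add_distrib, bridgeGFpos,
          Finset.sum_ite_eq' (Finset.range (M + 1)) 0 (fun _ => (1 : ℝ))]
        simp
    _ ≤ 1 + ρ / (1 - ρ) := by linarith [hB M]

end Literature.Probability.RandomPlanarGeometry.SAW.Zd

end
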